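import Summits.CriticalPhenomena.PercolationContinuityZ3.Theorems.PercNearOneGluingNoHeavyLowerTailSahiCombStrata

/-!
# The comb (tensor-Bernstein) hierarchy for Sahi's `E_k`, V: an ALL-ORDER unconditional row — triplewise meet-absorbing
# families (chains, meet towers, …) are comb-positive at every order

Support file of the one-cut programme (crux `NoHeavyLowerTail`, stmt-CriticalPhenomena-4575; cell `prim-masterthm`, seat P3; HIERARCHY.md §9).
The law-level statement is prim-l12-p5's THEOREM F (`…SahiHereditaryMeetAbsorption`: for every FKG weight, a family of monotone
indicators in which among any THREE members one contains the meet of the other two is Sahi-nonnegative at EVERY order) and THEOREM D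
(meet towers, `…SahiMeetTowerAllOrders`).  Here, for product measures, the conclusion is upgraded from `E_n ≥ 0` to COMB POSITIVITY
(a nonnegative degree-`n` tensor-Bernstein representation of `p ↦ E_n(μ_p; 1_U)`), for every `n`, unconditionally:

* `combPos_sahiE_ind_of_totalMeet_local` — the total-meet rung (R7′) of `…SahiCombStrata` with LOCAL hypotheses: comb positivity is
  required only of the proper sub-families of the given family (not of all families of lower order);
* `TriplewiseMeetAbsorbing U` — among any three distinct slots one event contains the intersection of the other two;
* **`combPos_sahiE_ind_of_triplewise`** — every triplewise meet-absorbing family of `n` increasing events has `E_n` comb-positive at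
  multidegree `n` (strong induction on `n`: one absorbing triple already gives a member containing the intersection of ALL the others,
  sub-families inherit the property, base `n ≤ 2` = (M⁺-2) `masterFamilyCombPos_two`);
* corollaries: CHAINS (`combPos_sahiE_ind_of_chain`) and MEET TOWERS (`combPos_sahiE_ind_of_meetTower`), every order; the law-level
  shadows `E_n(μ_p; 1_U) ≥ 0` (`sahiE_ind_nonneg_of_triplewise`).
This is the first all-`k`, all-`m` structured row of the comb table (HIERARCHY §4) beyond `k = 2`.  HONEST FRAMING: nothing here asserts
(M⁺-k) or `C_k` for `k ≥ 3` in general. [this work]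
-/

noncomputable section

open scoped Classical

namespace Summit.CriticalPhenomena.PercolationContinuityZ3.Theorems

open Finset Function
open scoped Nat
open Literature.Combinatorics.Sahi2008
open Literature.Probability.Percolation.DecisionTree (ind ind_of_mem ind_of_not_mem ind_nonneg)
open SahiComb

variable {ι : Type} [Fintype ι]

/-! ### The total-meet rung with local hypotheses -/

/-- **Total-meet rung, local form.**  For `k + 3` increasing events with a member `U_m ⊇ ⋂_{j} U_{m.succAbove j}`: if every PROPER sub-family
(along an injection `Fin j ↪ Fin (k+3)`, `j ≤ k + 2`) has `E_j` comb-positive at multidegree `j`, then `E_{k+3}(U)` is comb-positive at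
multidegree `k + 3` (defect expansion, as in `combPos_sahiE_ind_of_totalMeet`). [this work] -/
theorem combPos_sahiE_ind_of_totalMeet_local {k : ℕ} (U : Fin (k + 3) → Set (Set ι)) (m : Fin (k + 3))
    (hmeet : (⋂ j, U (m.succAbove j)) ⊆ U m)
    (hsub : ∀ (j : ℕ) (e : Fin j ↪ Fin (k + 3)), j ≤ k + 2 →
      CombPos (fun _ : ι => j) (fun p => sahiE (bernoulliWeight p) j (fun l => ind (U (e l))))) :
    CombPos (fun _ : ι => k + 3) (fun p => sahiE (bernoulliWeight p) (k + 3) (fun j => ind (U j))) := by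
  obtain ⟨τ, hτ⟩ := exists_perm_forall_sahiE_ind_eq_cons U m
  set V : Fin (k + 2) → Set (Set ι) := fun j => U (m.succAbove (τ j)) with hV
  -- the sub-family `V` and its sub-families are proper sub-families of `U`
  let eV : Fin (k + 2) ↪ Fin (k + 3) :=
    ⟨fun j => m.succAbove (τ j), fun a b hab => τ.injective (Fin.succAbove_right_injective hab)⟩
  have hmeetV : (⋂ j, V j) ⊆ U m := by
    refine Set.Subset.trans (fun ω hω => Set.mem_iInter.2 fun j => ?_) hmeet
    have := Set.mem_iInter.1 hω (τ.symm j)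
    simpa [hV] using this
  have hdef_nonneg : ∀ (T : Finset (Fin (k + 2))) (ω : Set ι),
      0 ≤ ((1 - ind (U m)) * ∏ i ∈ T, ind (V i)) ω := fun T ω => by
    simp only [Pi.mul_apply, Pi.sub_apply, Pi.one_apply, Finset.prod_apply]
    exact mul_nonneg (sub_nonneg.2 (ind_le_one' (U m) ω)) (prod_nonneg fun i _ => ind_nonneg _ _)
  have hdef_top : (1 - ind (U m)) * ∏ i, ind (V i) = 0 := by
    funext ω
    simp only [Pi.mul_apply, Pi.sub_apply, Pi.one_apply, Finset.prod_apply, Pi.zero_apply]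
    rw [prod_ind_eq_ind_iInter]
    by_cases hω : ω ∈ ⋂ i, V i
    · rw [ind_of_mem hω, ind_of_mem (hmeetV hω)]; ring
    · rw [ind_of_not_mem hω, mul_zero]
  have hhead : CombPos (fun _ : ι => 1) (fun p => ((k + 1 : ℕ) : ℝ) + 1 - ex (bernoulliWeight p) (ind (U m))) := by
    refine (combPos_const_sub_ex (h := ind (U m)) (a := ((k + 1 : ℕ) : ℝ) + 1) fun ω => ?_).congr fun p => by ring
    have := ind_le_one' (U m) ω
    have hk : (0 : ℝ) ≤ ((k + 1 : ℕ) : ℝ) := Nat.cast_nonneg _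
    linarith
  have hg : CombPos (fun _ : ι => k + 2) (fun p => sahiE (bernoulliWeight p) (k + 2) (fun j => ind (V j))) :=
    hsub (k + 2) eV le_rfl
  have hsubT : ∀ T : Finset (Fin (k + 2)), CombPos (fun _ : ι => Tᶜ.card)
      (fun p => sahiE (bernoulliWeight p) Tᶜ.card (fun j => ind (V (Tᶜ.orderEmbOfFin rfl j)))) := fun T =>
    hsub Tᶜ.card ((Tᶜ.orderEmbOfFin rfl).toEmbedding.trans eV) (by simpa using Finset.card_le_univ Tᶜ)
  have hdefect : ∀ T : Finset (Fin (k + 2)), CombPos (fun _ : ι => 1)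
      (fun p => ex (bernoulliWeight p) ((1 - ind (U m)) * ∏ i ∈ T, ind (V i))) := fun T =>
    combPos_ex (hdef_nonneg T)
  have hdeg : (fun _ : ι => (1 : ℕ)) + (fun _ : ι => k + 2) = fun _ : ι => k + 3 := by
    funext e; simp only [Pi.add_apply]; omega
  have hterm : ∀ T ∈ (univ : Finset (Finset (Fin (k + 2)))).filter (fun T => T.Nonempty ∧ T ≠ univ),
      CombPos (fun _ : ι => k + 3) (fun p => ((T.card)! : ℝ) *
        (ex (bernoulliWeight p) ((1 - ind (U m)) * ∏ i ∈ T, ind (V i)) *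
          sahiE (bernoulliWeight p) Tᶜ.card (fun j => ind (V (Tᶜ.orderEmbOfFin rfl j))))) := by
    intro T _
    refine ((hdefect T).mul_of_le (hsubT T) fun e => ?_).smul (Nat.cast_nonneg _)
    simp only [Pi.add_apply]
    have := Finset.card_le_univ Tᶜ
    simp only [Fintype.card_fin] at this
    omega
  have htot := ((hhead.mul_of_eq hg hdeg).add (CombPos.sum _ hterm)).add (CombPos.zero (fun _ : ι => k + 3))
  refine htot.congr fun p => ?_
  rw [hτ (bernoulliWeight p)]
  have hexp := SahiDefectExpansion.sahiE_cons_eq_defect_expansion (bernoulliWeight p) (k + 1) (ind (U m)) (fun j => ind (V j))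
  have hcons : (Matrix.vecCons (ind (U m)) fun j => ind (U (m.succAbove (τ j)))) =
      (Fin.cons (ind (U m)) (fun j => ind (V j)) : Fin (k + 1 + 2) → Set ι → ℝ) := rfl
  rw [hcons, hexp, hdef_top]
  have h0 : ex (bernoulliWeight p) (0 : Set ι → ℝ) = 0 := by simp [ex_def]
  have e2 : sahiE (bernoulliWeight p) (k + 1 + 1) (fun j => ind (V j)) =
      sahiE (bernoulliWeight p) (k + 2) (fun j => ind (V j)) := rfl
  rw [h0, e2]
  push_cast
  ring

/-! ### Triplewise meet-absorbing families -/

omit [Fintype ι] in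
/-- **Triplewise meet absorption**: among any three distinct slots, one event contains the intersection of the other two
(prim-l12-p5's THEOREM F hypothesis; chains, meet towers and Δ-systems of increasing events qualify). [this work] -/
def TriplewiseMeetAbsorbing {n : ℕ} (U : Fin n → Set (Set ι)) : Prop :=
  ∀ i j l : Fin n, i ≠ j → i ≠ l → j ≠ l → U j ∩ U l ⊆ U i ∨ U i ∩ U l ⊆ U j ∨ U i ∩ U j ⊆ U l

omit [Fintype ι] in
/-- Sub-families along injections inherit triplewise meet absorption. [this work] -/
theorem TriplewiseMeetAbsorbing.comp_embedding {n j : ℕ} {U : Fin n → Set (Set ι)} (h : TriplewiseMeetAbsorbing U)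
    (e : Fin j ↪ Fin n) : TriplewiseMeetAbsorbing (fun l => U (e l)) :=
  fun a b c hab hac hbc => h (e a) (e b) (e c) (fun h' => hab (e.injective h')) (fun h' => hac (e.injective h'))
    (fun h' => hbc (e.injective h'))

omit [Fintype ι] in
/-- In a triplewise meet-absorbing family with at least three members, some member contains the intersection of ALL the others
(if `U_i ⊇ U_j ∩ U_l` then `U_i ⊇ ⋂_{j' ≠ i} U_{j'}`). [this work] -/
theorem TriplewiseMeetAbsorbing.exists_totalMeet {k : ℕ} {U : Fin (k + 3) → Set (Set ι)} (h : TriplewiseMeetAbsorbing U) :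
    ∃ m : Fin (k + 3), (⋂ j, U (m.succAbove j)) ⊆ U m := by
  -- absorb inside the triple of slots `0, 1, 2`
  have key : ∀ (i j l : Fin (k + 3)), j ≠ i → l ≠ i → U j ∩ U l ⊆ U i → (⋂ j', U (i.succAbove j')) ⊆ U i := by
    intro i j l hji hli hsub
    obtain ⟨a, ha⟩ := Fin.exists_succAbove_eq hji
    obtain ⟨b, hb⟩ := Fin.exists_succAbove_eq hli
    refine Set.Subset.trans (fun ω hω => Set.mem_inter ?_ ?_) hsub
    · have := Set.mem_iInter.1 hω a; rwa [ha] at this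
    · have := Set.mem_iInter.1 hω b; rwa [hb] at this
  set i0 : Fin (k + 3) := ⟨0, by omega⟩
  set i1 : Fin (k + 3) := ⟨1, by omega⟩
  set i2 : Fin (k + 3) := ⟨2, by omega⟩
  have h01 : i0 ≠ i1 := by simp [i0, i1]
  have h02 : i0 ≠ i2 := by simp [i0, i2]
  have h12 : i1 ≠ i2 := by simp [i1, i2]
  rcases h i0 i1 i2 h01 h02 h12 with h0 | h1 | h2
  · exact ⟨i0, key i0 i1 i2 h01.symm h02.symm h0⟩
  · exact ⟨i1, key i1 i0 i2 h01 h12.symm h1⟩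
  · exact ⟨i2, key i2 i0 i1 h02 h12 h2⟩

/-- **Triplewise meet-absorbing families are comb-positive at EVERY order** (unconditional, all `n`, every finite cube): for `n` increasing
events among any three of which one contains the intersection of the other two, `p ↦ E_n(μ_p; 1_{U_0},…,1_{U_{n−1}})` is a nonnegative
combination of the degree-`n` tensor-Bernstein basis.  Proof: strong induction on `n` through the local total-meet rung; base (M⁺-2). [this work] -/
theorem combPos_sahiE_ind_of_triplewise :
    ∀ (n : ℕ) {ι : Type} [Fintype ι] (U : Fin n → Set (Set ι)), (∀ j, IsUpperSet (U j)) → TriplewiseMeetAbsorbing U →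
      CombPos (fun _ : ι => n) (fun p => sahiE (bernoulliWeight p) n (fun j => ind (U j))) := by
  intro n
  induction n using Nat.strong_induction_on with
  | _ n ih =>
    intro ι _ U hU hT
    rcases Nat.lt_or_ge n 3 with hn | hn
    · exact masterFamilyCombPos_of_le_two (by omega) ι U hU
    · obtain ⟨k, rfl⟩ : ∃ k, n = k + 3 := ⟨n - 3, by omega⟩
      obtain ⟨m, hmeet⟩ := hT.exists_totalMeet
      exact combPos_sahiE_ind_of_totalMeet_local U m hmeet fun j e hj =>
        ih j (by omega) (fun l => U (e l)) (fun l => hU _) (hT.comp_embedding e)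

/-- Law-level shadow: `E_n(μ_p; 1_U) ≥ 0` for every triplewise meet-absorbing family of increasing events, every `n`, every `p`
(prim-l12-p5's THEOREM F for product measures, re-proved through comb positivity). [this work] -/
theorem sahiE_ind_nonneg_of_triplewise {n : ℕ} (p : ι → unitInterval) (U : Fin n → Set (Set ι)) (hU : ∀ j, IsUpperSet (U j))
    (hT : TriplewiseMeetAbsorbing U) : 0 ≤ sahiE (bernoulliWeight p) n (fun j => ind (U j)) :=
  (combPos_sahiE_ind_of_triplewise n U hU hT).nonneg p

/-! ### Chains and meet towers -/

omit [Fintype ι] in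
/-- A family of pairwise comparable events is triplewise meet-absorbing. [this work] -/
theorem triplewiseMeetAbsorbing_of_chain {n : ℕ} {U : Fin n → Set (Set ι)} (h : ∀ i j : Fin n, U i ⊆ U j ∨ U j ⊆ U i) :
    TriplewiseMeetAbsorbing U := by
  intro i j l _ _ _
  rcases h i j with hij | hji
  · exact Or.inr (Or.inl (Set.Subset.trans Set.inter_subset_left hij))
  · exact Or.inl (Set.Subset.trans Set.inter_subset_left hji)

/-- **Chains are comb-positive at every order**: for `n` pairwise comparable increasing events, `E_n(μ_p; 1_U)` has a nonnegative degree-`n`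
tensor-Bernstein representation (the comb form of Sahi positivity on chains). [this work] -/
theorem combPos_sahiE_ind_of_chain {n : ℕ} (U : Fin n → Set (Set ι)) (hU : ∀ j, IsUpperSet (U j))
    (h : ∀ i j : Fin n, U i ⊆ U j ∨ U j ⊆ U i) :
    CombPos (fun _ : ι => n) (fun p => sahiE (bernoulliWeight p) n (fun j => ind (U j))) :=
  combPos_sahiE_ind_of_triplewise n U hU (triplewiseMeetAbsorbing_of_chain h)

omit [Fintype ι] in
/-- A MEET TOWER (each slot contains the pairwise intersections of all later slots) is triplewise meet-absorbing. [this work] -/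
theorem triplewiseMeetAbsorbing_of_meetTower {n : ℕ} {U : Fin n → Set (Set ι)}
    (h : ∀ i j l : Fin n, i < j → i < l → j ≠ l → U j ∩ U l ⊆ U i) : TriplewiseMeetAbsorbing U := by
  intro i j l hij hil hjl
  -- the smallest of the three indices absorbs the other two
  rcases lt_trichotomy i j with h1 | h1 | h1
  · rcases lt_trichotomy i l with h2 | h2 | h2
    · exact Or.inl (h i j l h1 h2 hjl)
    · exact absurd h2 hil
    · refine Or.inr (Or.inr ?_)
      exact h l i j h2 (h2.trans h1) hij
  · exact absurd h1 hij
  · rcases lt_trichotomy j l with h2 | h2 | h2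
    · refine Or.inr (Or.inl ?_)
      exact h j i l h1 h2 hil
    · exact absurd h2 hjl
    · refine Or.inr (Or.inr ?_)
      rw [Set.inter_comm]
      exact h l j i h2 (h2.trans h1) hij.symm

/-- **Meet towers are comb-positive at every order** (the comb form of prim-l12-p5's THEOREM D for product measures). [this work] -/
theorem combPos_sahiE_ind_of_meetTower {n : ℕ} (U : Fin n → Set (Set ι)) (hU : ∀ j, IsUpperSet (U j))
    (h : ∀ i j l : Fin n, i < j → i < l → j ≠ l → U j ∩ U l ⊆ U i) :
    CombPos (fun _ : ι => n) (fun p => sahiE (bernoulliWeight p) n (fun j => ind (U j))) :=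
  combPos_sahiE_ind_of_triplewise n U hU (triplewiseMeetAbsorbing_of_meetTower h)

end Summit.CriticalPhenomena.PercolationContinuityZ3.Theorems
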